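import Summits.CriticalPhenomena.PercolationContinuityZ3.Theorems.PercNearOneGluingNoHeavyLowerTailSahiFreeSlotFourModel
import Summits.CriticalPhenomena.PercolationContinuityZ3.Theorems.PercNearOneGluingNoHeavyLowerTailSahiFreeSlotAbel
import Summits.CriticalPhenomena.PercolationContinuityZ3.Theorems.PercNearOneGluingNoHeavyLowerTailSahiFreeSlotCells
import HarnessLib

/-!
# `NoHeavyLowerTail` (stmt-CriticalPhenomena-4575) — free-slot region reduction, MODEL SIDE II: monotonicity of the free slot across the cells
# and the assembly of F(4,1)∀X from the certificate

Support file, seat `prim-l12-p5` (gen 17), `--supports stmt-CriticalPhenomena-4575`.  Standard axioms, no sorries, no named facts (the certificate enters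
as the HYPOTHESIS `checkAll = true`, discharged by `native_decide` in `…SahiFreeSlotFourCert` and combined in `…SahiFreeSlotFour`).
Memo FROM-prim-l12-p5-g17-FREE-SLOT-REGION-REDUCTION §1(iii)–(vi):
* `vcell` (`v_R = E[1_X·1_{rho=R}]`), `vcell_cover` (covering step `v_R(1−rr_i) ≤ rr_i v_{R∪i}` by pinning the coins of region `i`), `vcell_chain`,
  **`cell_mono`** (`R ⊆ R' ⟹ v_R·P_{R'} ≤ v_{R'}·P_R`);
* `zeta_eq` — the cell coefficient of `…SahiFreeSlotCells.sahiE_four_eq_sum_cells` IS `z_{patt R}` of `…SahiFreeSlotFourData` at `r = rr p A`;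
* **`sahiE4_upper_hit_nonneg_of_checkAll`** — `checkAll = true ⟹ 0 ≤ E_4(1_X, 1_{H_{A_0}}, 1_{H_{A_1}}, 1_{H_{A_2}})` for every product measure, every
  up-set `X`, all finite `A_j` (Abel lemma `…SahiFreeSlotAbel` with the up-set inequalities `sum_upper_nonneg_of_checkAll`). [this work]
-/

namespace Summit.CriticalPhenomena.PercolationContinuityZ3.Theorems

namespace SahiFreeSlot

open Finset Literature.Combinatorics.Sahi2008 SahiHitting
open Literature.Probability.Percolation.DecisionTree (ind ind_of_mem ind_of_not_mem ind_nonneg)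

variable {ι : Type*} [Fintype ι] [DecidableEq ι]

/-! ## Monotonicity of the free slot across cells -/

open Classical in
/-- The constraint on the regions other than `i`. [this work] -/
noncomputable def dInd (A : Fin 3 → Finset ι) (R : Finset (Fin 7)) (i : Fin 7) (ω : Set ι) : ℝ :=
  if (∀ j, j ≠ i → (j ∈ R ↔ j ∈ rho A ω)) then 1 else 0

/-- Inserting a coin of region `i` does not change the hits of the other regions. [this work] -/
theorem mem_rho_insert_of_ne (A : Fin 3 → Finset ι) {i j : Fin 7} (hji : j ≠ i) {c : ι} (hc : c ∈ region A i) (ω : Set ι) :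
    j ∈ rho A (insert c ω) ↔ j ∈ rho A ω := by
  rw [mem_rho, mem_rho]
  constructor
  · rintro ⟨c', hc', hc'ω⟩
    rcases Set.mem_insert_iff.1 hc'ω with rfl | h
    · exact absurd hc (Finset.disjoint_left.1 (region_disjoint A hji) hc')
    · exact ⟨c', hc', h⟩
  · rintro ⟨c', hc', hc'ω⟩
    exact ⟨c', hc', Set.mem_insert_of_mem c hc'ω⟩

/-- `dInd` is unchanged by inserting a coin of region `i`. [this work] -/
theorem dInd_insert (A : Fin 3 → Finset ι) (R : Finset (Fin 7)) (i : Fin 7) {c : ι} (hc : c ∈ region A i) (ω : Set ι) :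
    dInd A R i (insert c ω) = dInd A R i ω := by
  unfold dInd
  have h : (∀ j, j ≠ i → (j ∈ R ↔ j ∈ rho A (insert c ω))) ↔ (∀ j, j ≠ i → (j ∈ R ↔ j ∈ rho A ω)) :=
    forall_congr' fun j => imp_congr_right fun hji => by rw [mem_rho_insert_of_ne A hji hc]
  simp only [h]

/-- The two cells of a covering pair, through `dInd` and the miss indicator of region `i`. [this work] -/
theorem cellInd_eq_dInd_mul (A : Fin 3 → Finset ι) {R : Finset (Fin 7)} {i : Fin 7} (hi : i ∉ R) (ω : Set ι) :
    cellInd A R ω = dInd A R i ω * missInd A i ω ∧ cellInd A (insert i R) ω = dInd A R i ω * (1 - missInd A i ω) := by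
  rw [missInd_eq]
  unfold cellInd dInd
  by_cases hD : ∀ j, j ≠ i → (j ∈ R ↔ j ∈ rho A ω)
  · rw [if_pos hD]
    by_cases hir : i ∈ rho A ω
    · rw [if_pos hir]
      have hne : rho A ω ≠ R := fun h => hi (h ▸ hir)
      have heq : rho A ω = insert i R := by
        ext j
        rw [mem_insert]
        by_cases hji : j = i
        · subst hji; exact ⟨fun _ => Or.inl rfl, fun _ => hir⟩
        · rw [← hD j hji]; exact ⟨fun h => Or.inr h, fun h => h.resolve_left hji⟩
      rw [if_neg hne, if_pos heq]
      norm_num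
    · rw [if_neg hir]
      have heq : rho A ω = R := by
        ext j
        by_cases hji : j = i
        · subst hji; exact ⟨fun h => absurd h hir, fun h => absurd h hi⟩
        · exact (hD j hji).symm
      have hne : rho A ω ≠ insert i R := fun h => hir (h ▸ mem_insert_self i R)
      rw [if_pos heq, if_neg hne]
      norm_num
  · rw [if_neg hD]
    have hne1 : rho A ω ≠ R := fun h => hD fun j _ => by rw [h]
    have hne2 : rho A ω ≠ insert i R := fun h => hD fun j hji => by
      rw [h, mem_insert]
      exact ⟨fun hj => Or.inr hj, fun hj => hj.resolve_left hji⟩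
    rw [if_neg hne1, if_neg hne2]
    norm_num

/-- The free-slot cell moments `v_R = E[f · 1_{rho = R}]`. [this work] -/
noncomputable def vcell (p : ι → unitInterval) (f : Set ι → ℝ) (A : Fin 3 → Finset ι) (R : Finset (Fin 7)) : ℝ :=
  ex (bernoulliWeight p) (fun ω => f ω * cellInd A R ω)

/-- `v_R ≥ 0` for `f ≥ 0`. [this work] -/
theorem vcell_nonneg (p : ι → unitInterval) {f : Set ι → ℝ} (hf0 : ∀ ω, 0 ≤ f ω) (A : Fin 3 → Finset ι) (R : Finset (Fin 7)) :
    0 ≤ vcell p f A R :=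
  ex_nonneg (isFKGMeasure_bernoulliWeight p).nonneg fun ω => mul_nonneg (hf0 ω) (by unfold cellInd; split_ifs <;> norm_num)

/-- `v_R = 0` on cells of mass `0`. [this work] -/
theorem vcell_eq_zero (p : ι → unitInterval) (f : Set ι → ℝ) (A : Fin 3 → Finset ι) {R : Finset (Fin 7)} (hR : cellProb (rr p A) R = 0) :
    vcell p f A R = 0 := by
  rw [← ex_cellInd] at hR
  unfold ex at hR
  have hterm : ∀ ω ∈ (Finset.univ : Finset (Set ι)), bernoulliWeight p ω * cellInd A R ω = 0 :=
    (sum_eq_zero_iff_of_nonneg fun ω _ => mul_nonneg ((isFKGMeasure_bernoulliWeight p).nonneg ω)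
      (by unfold cellInd; split_ifs <;> norm_num)).1 hR
  unfold vcell ex
  refine sum_eq_zero fun ω hω => ?_
  have := hterm ω hω
  calc bernoulliWeight p ω * (f ω * cellInd A R ω) = f ω * (bernoulliWeight p ω * cellInd A R ω) := by ring
    _ = 0 := by rw [this, mul_zero]

/-- **Covering step**: for `i ∉ R` and a monotone `f`, `v_R · (1 − rr_i) ≤ rr_i · v_{R ∪ {i}}`. [this work] -/
theorem vcell_cover {f : Set ι → ℝ} (hf : Monotone f) (p : ι → unitInterval) (A : Fin 3 → Finset ι) {R : Finset (Fin 7)} {i : Fin 7}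
    (hi : i ∉ R) : vcell p f A R * (1 - rr p A i) ≤ rr p A i * vcell p f A (insert i R) := by
  set g : Set ι → ℝ := fun ω => f ω * dInd A R i ω with hg
  have hgins : ∀ c ∈ region A i, ∀ ω, g ω ≤ g (insert c ω) := by
    intro c hc ω
    simp only [hg, dInd_insert A R i hc]
    refine mul_le_mul_of_nonneg_right (hf (Set.subset_insert c ω)) ?_
    unfold dInd; split_ifs <;> norm_num
  have hpin := ex_mul_missSet_le p (region A i) g hgins
  -- identify the three expectations
  have e1 : ex (bernoulliWeight p) (fun ω => g ω * ind {ω : Set ι | ∀ c ∈ region A i, c ∉ ω} ω) = vcell p f A R := by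
    unfold vcell
    refine congrArg _ (funext fun ω => ?_)
    rw [(cellInd_eq_dInd_mul A hi ω).1, hg]
    unfold missInd; ring
  have e2 : ex (bernoulliWeight p) g = vcell p f A R + vcell p f A (insert i R) := by
    unfold vcell
    rw [← ex_add]
    refine congrArg _ (funext fun ω => ?_)
    rw [Pi.add_apply, (cellInd_eq_dInd_mul A hi ω).1, (cellInd_eq_dInd_mul A hi ω).2, hg]
    ring
  rw [e1, e2] at hpin
  have : rr p A i = ∏ c ∈ region A i, (1 - (p c : ℝ)) := rfl
  rw [← this] at hpin
  nlinarith [hpin]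

/-- **Chain**: for `T` disjoint from `R`, `v_R · ∏_{T}(1 − rr) ≤ v_{R ∪ T} · ∏_{T} rr`. [this work] -/
theorem vcell_chain {f : Set ι → ℝ} (hf : Monotone f) (p : ι → unitInterval) (A : Fin 3 → Finset ι) (R T : Finset (Fin 7))
    (hRT : Disjoint R T) : vcell p f A R * ∏ j ∈ T, (1 - rr p A j) ≤ vcell p f A (R ∪ T) * ∏ j ∈ T, rr p A j := by
  induction T using Finset.induction_on with
  | empty => simp
  | insert i T hiT ih =>
    have hdis : Disjoint R T := Disjoint.mono_right (subset_insert i T) hRT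
    have hiR : i ∉ R := fun h => Finset.disjoint_left.1 hRT h (mem_insert_self i T)
    have hiRT : i ∉ R ∪ T := by rw [mem_union]; push Not; exact ⟨hiR, hiT⟩
    have h1 := ih hdis
    have h2 := vcell_cover hf p A hiRT
    rw [prod_insert hiT, prod_insert hiT, union_insert]
    have hq0 : 0 ≤ 1 - rr p A i := sub_nonneg.2 (rr_mem_unit p A i).2
    have hq1 : 0 ≤ ∏ j ∈ T, rr p A j := prod_nonneg fun j _ => (rr_mem_unit p A j).1
    calc vcell p f A R * ((1 - rr p A i) * ∏ j ∈ T, (1 - rr p A j))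
        = (vcell p f A R * ∏ j ∈ T, (1 - rr p A j)) * (1 - rr p A i) := by ring
      _ ≤ (vcell p f A (R ∪ T) * ∏ j ∈ T, rr p A j) * (1 - rr p A i) := mul_le_mul_of_nonneg_right h1 hq0
      _ = (vcell p f A (R ∪ T) * (1 - rr p A i)) * ∏ j ∈ T, rr p A j := by ring
      _ ≤ (rr p A i * vcell p f A (insert i (R ∪ T))) * ∏ j ∈ T, rr p A j := mul_le_mul_of_nonneg_right h2 hq1
      _ = vcell p f A (insert i (R ∪ T)) * (rr p A i * ∏ j ∈ T, rr p A j) := by ring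

/-- **Monotonicity of the free slot across cells**: for an up-set `X` and `R ⊆ R'`, `v_R · P_{R'} ≤ v_{R'} · P_R`. [this work] -/
theorem cell_mono {f : Set ι → ℝ} (hf : Monotone f) (p : ι → unitInterval) (A : Fin 3 → Finset ι)
    {R R' : Finset (Fin 7)} (h : R ⊆ R') : vcell p f A R * cellProb (rr p A) R' ≤ vcell p f A R' * cellProb (rr p A) R := by
  set T := R' \ R with hT
  have hRT : Disjoint R T := disjoint_sdiff
  have hR' : R ∪ T = R' := union_sdiff_of_subset h
  have hc := vcell_chain hf p A R T hRT
  rw [hR'] at hc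
  -- split both cell masses over `T` and its complement
  have hsplit : ∀ S : Finset (Fin 7), cellProb (rr p A) S
      = (∏ j ∈ T, (if j ∈ S then 1 - rr p A j else rr p A j)) * ∏ j ∈ Tᶜ, (if j ∈ S then 1 - rr p A j else rr p A j) :=
    fun S => (prod_mul_prod_compl T _).symm
  have hT1 : ∏ j ∈ T, (if j ∈ R' then 1 - rr p A j else rr p A j) = ∏ j ∈ T, (1 - rr p A j) :=
    prod_congr rfl fun j hj => by rw [hT, mem_sdiff] at hj; rw [if_pos hj.1]
  have hT0 : ∏ j ∈ T, (if j ∈ R then 1 - rr p A j else rr p A j) = ∏ j ∈ T, rr p A j :=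
    prod_congr rfl fun j hj => by rw [hT, mem_sdiff] at hj; rw [if_neg hj.2]
  have hC : ∏ j ∈ Tᶜ, (if j ∈ R' then 1 - rr p A j else rr p A j) = ∏ j ∈ Tᶜ, (if j ∈ R then 1 - rr p A j else rr p A j) :=
    prod_congr rfl fun j hj => by
      rw [mem_compl, hT, mem_sdiff] at hj
      push Not at hj
      have : j ∈ R' ↔ j ∈ R := ⟨hj, fun hjR => h hjR⟩
      simp only [this]
  have hCnn : 0 ≤ ∏ j ∈ Tᶜ, (if j ∈ R then 1 - rr p A j else rr p A j) :=
    prod_nonneg fun j _ => by split_ifs <;> linarith [(rr_mem_unit p A j).1, (rr_mem_unit p A j).2]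
  rw [hsplit R', hsplit R, hT1, hT0, hC]
  calc vcell p f A R * ((∏ j ∈ T, (1 - rr p A j)) * ∏ j ∈ Tᶜ, (if j ∈ R then 1 - rr p A j else rr p A j))
      = (vcell p f A R * ∏ j ∈ T, (1 - rr p A j)) * ∏ j ∈ Tᶜ, (if j ∈ R then 1 - rr p A j else rr p A j) := by ring
    _ ≤ (vcell p f A R' * ∏ j ∈ T, rr p A j) * ∏ j ∈ Tᶜ, (if j ∈ R then 1 - rr p A j else rr p A j) :=
        mul_le_mul_of_nonneg_right hc hCnn
    _ = vcell p f A R' * ((∏ j ∈ T, rr p A j) * ∏ j ∈ Tᶜ, (if j ∈ R then 1 - rr p A j else rr p A j)) := by ring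

/-! ## Assembly -/

/-- The cell coefficient of the generic decomposition is `z_{patt R}` at `r = rr`. [this work] -/
theorem zeta_eq (hN : allNodes.Nodup) (m : Fin 7 → ℝ) (n : Finset (Fin 7)) :
    (6 * (gam 0 n * gam 1 n * gam 2 n)
        + (-2 * ∑ k, gam 0 k * cellProb m k) * (gam 1 n * gam 2 n) + (-2 * ∑ k, gam 1 k * cellProb m k) * (gam 0 n * gam 2 n)
        + (-2 * ∑ k, gam 2 k * cellProb m k) * (gam 0 n * gam 1 n)
        + (-((∑ k, gam 1 k * gam 2 k * cellProb m k) - (∑ k, gam 1 k * cellProb m k) * (∑ k, gam 2 k * cellProb m k))) * gam 0 n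
        + (-((∑ k, gam 0 k * gam 2 k * cellProb m k) - (∑ k, gam 0 k * cellProb m k) * (∑ k, gam 2 k * cellProb m k))) * gam 1 n
        + (-((∑ k, gam 0 k * gam 1 k * cellProb m k) - (∑ k, gam 0 k * cellProb m k) * (∑ k, gam 1 k * cellProb m k))) * gam 2 n
        + (-(2 * (∑ k, gam 0 k * gam 1 k * gam 2 k * cellProb m k)
            + (∑ k, gam 0 k * cellProb m k) * (∑ k, gam 1 k * cellProb m k) * (∑ k, gam 2 k * cellProb m k)
            - ((∑ k, gam 0 k * cellProb m k) * (∑ k, gam 1 k * gam 2 k * cellProb m k)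
              + (∑ k, gam 1 k * cellProb m k) * (∑ k, gam 0 k * gam 2 k * cellProb m k)
              + (∑ k, gam 2 k * cellProb m k) * (∑ k, gam 0 k * gam 1 k * cellProb m k)))))
      = evalKL 7 (zWK (patt n)) m := by
  -- the moment atoms
  have hsum : ∀ W : Finset (Fin 3), (∑ k, (if W ⊆ patt k then (1 : ℝ) else 0) * cellProb m k) = evalKL 7 (mK W) m := by
    intro W
    rw [evalKL_mK hN, sum_filter]
    exact sum_congr rfl fun k _ => by split_ifs <;> simp
  have g1 : ∀ (j : Fin 3) k, gam j k = if ({j} : Finset (Fin 3)) ⊆ patt k then (1 : ℝ) else 0 := fun j k => by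
    simp only [gam, singleton_subset_iff]
  have g2 : ∀ (j l : Fin 3) k, gam j k * gam l k = if ({j, l} : Finset (Fin 3)) ⊆ patt k then (1 : ℝ) else 0 := fun j l k => by
    simp only [gam, insert_subset_iff, singleton_subset_iff]
    by_cases hj : j ∈ patt k <;> by_cases hl : l ∈ patt k <;> simp [hj, hl]
  have g3 : ∀ k, gam 0 k * gam 1 k * gam 2 k = if ({0, 1, 2} : Finset (Fin 3)) ⊆ patt k then (1 : ℝ) else 0 := fun k => by
    simp only [gam, insert_subset_iff, singleton_subset_iff]
    by_cases h0 : (0 : Fin 3) ∈ patt k <;> by_cases h1 : (1 : Fin 3) ∈ patt k <;> by_cases h2 : (2 : Fin 3) ∈ patt k <;> simp [h0, h1, h2]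
  simp only [g3]
  simp only [g2]
  simp only [g1]
  simp only [hsum]
  rw [evalKL_zWK, evalKL_c12K, evalKL_c02K, evalKL_c01K, evalKL_E3K]
  simp only [m0K, m1K, m2K, m01K, m02K, m12K, m012K, gamW, insert_subset_iff, singleton_subset_iff]
  by_cases h0 : (0 : Fin 3) ∈ patt n <;> by_cases h1 : (1 : Fin 3) ∈ patt n <;> by_cases h2 : (2 : Fin 3) ∈ patt n <;>
    simp [h0, h1, h2] <;> ring

/-- **F(4,1) for a free monotone slot, from the certificate**: if `checkAll = true` then for every product measure, every monotone `f ≥ 0` and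
all finite `A_0,A_1,A_2`, `0 ≤ E_4(f, 1_{H_{A_0}}, 1_{H_{A_1}}, 1_{H_{A_2}})`. [this work; cite: Sahi2008, Conj. 5; LiebSahi2021, Conj. 1.1] -/
theorem sahiE4_mono_hit_nonneg_of_checkAll (hall : checkAll = true) (p : ι → unitInterval) {f : Set ι → ℝ} (hf : Monotone f)
    (hf0 : ∀ ω, 0 ≤ f ω) (A : Fin 3 → Finset ι) :
    0 ≤ sahiE (bernoulliWeight p) 4 ![f, ind {ω : Set ι | ∃ a ∈ A 0, a ∈ ω}, ind {ω : Set ι | ∃ a ∈ A 1, a ∈ ω},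
      ind {ω : Set ι | ∃ a ∈ A 2, a ∈ ω}] := by
  have hN : allNodes.Nodup := by
    have h := hall
    rw [checkAll, Bool.and_eq_true, Bool.and_eq_true] at h
    exact of_decide_eq_true h.1.1
  set m : Fin 7 → ℝ := rr p A with hm
  have hmbox : ∀ i, 0 ≤ m i ∧ m i ≤ 1 := fun i => rr_mem_unit p A i
  have key := sahiE_four_eq_sum_cells (bernoulliWeight p) f
    (ind {ω : Set ι | ∃ a ∈ A 0, a ∈ ω}) (ind {ω : Set ι | ∃ a ∈ A 1, a ∈ ω}) (ind {ω : Set ι | ∃ a ∈ A 2, a ∈ ω})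
    (rho A) (gam 0) (gam 1) (gam 2) (ind_hit_eq_gam_rho A 0) (ind_hit_eq_gam_rho A 1) (ind_hit_eq_gam_rho A 2)
    (cellProb m) (vcell p f A) (fun R => (ex_cellInd p A R).symm) (fun R => rfl)
  rw [key]
  simp only [zeta_eq hN m]
  exact sum_mul_nonneg_of_upperSets (fun R => evalKL 7 (zWK (patt R)) m) (cellProb m) (vcell p f A)
    (cellProb_nonneg hmbox) (vcell_nonneg p hf0 A) (fun R hR => vcell_eq_zero p f A hR)
    (fun R R' hRR' => cell_mono hf p A hRR')
    (fun U hU => sum_upper_nonneg_of_checkAll hall m hmbox U hU)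

/-- **F(4,1)∀X from the certificate**: if `checkAll = true` then for every product measure, every up-set `X` and all finite `A_0,A_1,A_2`,
`0 ≤ E_4(1_X, 1_{H_{A_0}}, 1_{H_{A_1}}, 1_{H_{A_2}})`. [this work; cite: Sahi2008, Conj. 5; LiebSahi2021, Conj. 1.1] -/
theorem sahiE4_upper_hit_nonneg_of_checkAll (hall : checkAll = true) (p : ι → unitInterval) {X : Set (Set ι)} (hX : IsUpperSet X)
    (A : Fin 3 → Finset ι) :
    0 ≤ sahiE (bernoulliWeight p) 4 ![ind X, ind {ω : Set ι | ∃ a ∈ A 0, a ∈ ω}, ind {ω : Set ι | ∃ a ∈ A 1, a ∈ ω},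
      ind {ω : Set ι | ∃ a ∈ A 2, a ∈ ω}] :=
  sahiE4_mono_hit_nonneg_of_checkAll hall p (monotone_ind_of_isUpperSet hX) (ind_nonneg X) A

end SahiFreeSlot

end Summit.CriticalPhenomena.PercolationContinuityZ3.Theorems
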